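import Literature.MathematicalPhysics.QuantumFieldTheory.Balaban1983to89.B9Thm311SitePrimeFormCoerciveTowerBlockGauge
import Literature.MathematicalPhysics.QuantumFieldTheory.Balaban1983to89.B7Eq47BlockGaugeTowerBonds
import Literature.MathematicalPhysics.QuantumFieldTheory.Balaban1983to89.B9Eq384RemainderLetters
import Literature.MathematicalPhysics.QuantumFieldTheory.Balaban1983to89.B9Thm311SmallFieldClosed

/-!
# `Balaban1983to89.B9Thm311SitePrimeFormCoerciveTowerPlaquette` — T. Bałaban, *Propagators for lattice gauge theories in a background field*, Commun.
# Math. Phys. **99** (1985) 389–434 [Balaban1985BackgroundPropagators] Thm 3.11 p. 416 («Δ′_a … positive definite») with (3.24) p. 394, (3.31)–(3.32)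
# p. 395, (3.35) p. 396, and [Balaban1985Averaging] Prop. 2 (52)–(54) p. 26: **THE k-LEVEL SITE OPERATOR `Δ′_{a′,k}(U)` IS STRONGLY COERCIVE AT EVERY
# BACKGROUND OF THE GAUGE-INVARIANT PLAQUETTE CLASS (52), WITH A LEVEL-FREE CONSTANT** — `(1∕(3+4∕a′))·(‖D_Uλ‖² + (1 − κ₀)(ηN)⁻²‖λ‖²) ≤
# re⟨λ, Δ′_{a′,k}(U)λ⟩`, `κ₀ = 8d³A² + 4(2dCA·e^{2dCA})²`, `A = M_φM_φ′α₀`, `C = d + 256(d+1)(d+4)`, `N = L^{n+1}`: no `η`, `m`, `c₀, c₁`, NO NUMBER OF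
# LEVELS; and `∃ A₁ γ > 0` BEFORE `∀ L S n m U α₀ η c₀ c₁ λ` — brick (T5), the k-twin of this lineage's (P2) `B9Thm311SitePrimeFormCoercivePlaquette`

statement-level skeleton of published theorems with citation tags; proofs where landed; nothing here is a claim about the Yang–Mills mass gap

CITATION HEADER (lean-in-tree rule).  Audit cell `pub-balaban`, sub-cell `t4`, BINDER row NE9; filed by NE9 formalisation-swarm leaf prover 03
(`b2b-balaban-t4-ne9-formalise-leaf-03`, gen 64), brick (T5) of the k-level Tier P programme (journal l.47756).  Sources READ in the held text: [B9]
pp. 394–396, 416 (`paper:balaban1985-cmp99-background-propagators` p0006–p0008, p0028); [B7] p. 26 via `B7Prop2Explicit`'s verbatim header.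
Objects BY NAME: (T4b) `site_strong_coercive_blockGauge_tower`, (T2) `norm_gaugeU_blockAxial_sub_one_le` ∕ `norm_UlevOf_blockAxial_sub_one_le_profile`,
`B7Eq44TorusAxialGaugeLocal.axialGaugeTAt(_mem_U1)`, `B9Eq384RemainderLetters.norm_adTransportW_sub_le`, `B9Thm311SmallFieldClosed.hRS_of_unitary`,
`B9Eq328GaugeAction.inner_AdW_AdW_of_compat` ∕ `tau_AdA_of_trace`, lit-balaban's `avgIter_mem` ∕ `pdev_gaugeAct`; nothing re-declared, 0 `def`.

THE PRINT (verbatim).  [B9] Thm 3.11 p. 416: *«There exist constants … such that for U satisfying (3.35) … Δ′_a, G′, (Q′G′²Q′*)⁻¹, Δ_a, G are positive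
definite»*; p. 396 (3.35): *«there exists a gauge transformation u on □ such that U^u = e^{iηA}, |A| ≤ …α₀»* — the hypothesis is on the PLAQUETTE
variables of `U`, cube by cube; p. 395: *«Δ′_a is positive»*, (3.31)–(3.32).  [B7] (52): *«|U(∂p) − 1| < α₀η², η = L^{−k}»*.

WHAT IS PROVED (sorry-free; proof lane — 0 `def`; [folklore] composition of landed letters + threshold arithmetic).
* §1 suppliers of (T4b)'s displayed slots at the class: `inner_AdW_blockAxial` (`hAd`), `over_shift_of_blockCoord_eq`, `UlevOf_gauged_mem` (the level
  backgrounds of `U^{u_y}` are `S`-valued under (52)), **`norm_adTransportW_blockAxial_sub_le`** (`hR`: `ε = 2M_φM_φ′·|n|₁·pdev Ũ`, (T2)'s fine letter),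
  **`norm_adTransportW_UlevOf_blockAxial_sub_le`** (`hRlev`: `ε_j = 2M_φM_φ′·Cα₀L^{n−j}∕N`, (T2)'s profile).
* §2 **`site_strong_coercive_tower_of_small_plaquettes`** — [B9] THM 3.11 FOR THE k-LEVEL SITE OPERATOR AT THE CLASS (52), STRONG FORM, EXPLICIT LETTERS
  (unitary `U` on `T_{L^{n+1}m}`, `2 ≤ m_i`, `2 ≤ L`, values in an averaging-closed `S ≤ U1`, `C₀α₀ ≤ ⅓`, `2α₀ ≤ c₂′`, `pdev Ũ < α₀N⁻²`, `c₁(ηN)² = c₀N^d`).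
* §3 **`site_strong_coercive_tower_of_small_plaquettes_canonical`** — THE LEVEL-FREE CONSTANT `κ_k ≤ κ₀` (`2d(N−1)N·ε² ≤ 8d³A²` from `|n|₁ ≤ dN`;
  `Σ_{j≤n} ε_j ≤ 2CA∕(L−1)` by the geometric sum, so `Π_j(1+ε_j)^{d(L−1)} − 1 ≤ 2dCA·e^{2dCA}`); `laplacePrimeAk_pos_of_small_plaquettes` (`hpos′` at `κ₀ < 1`).
* §4 **`exists_site_strong_coercive_tower_of_small_plaquettes`** — `∃ A₁(d) γ(a′) > 0` BEFORE `∀ L S n m U α₀ η c₀ c₁ λ`: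
  `γ·(‖D_Uλ‖² + (ηN)⁻²‖λ‖²) ≤ re⟨λ, Δ′_{a′,k}(U)λ⟩` whenever `M_φM_φ′α₀ ≤ A₁` at the class — print's «there exist constants», uniformly in the tower.
HONEST SCOPE.  [folklore] composition; the class (52) (plaquettes of `U`, gauge-INVARIANT) + unitarity + `2 ≤ m_i`, `2 ≤ L` are the ONLY hypotheses on
the background — no bond window, no profile, no closed line displayed; the constant is explicit and level-free («O(1)», p. 395).  NOT the bond operator
`Δ_a` ((SC-k), the owner's files on print's (3.36)–(3.37) domain), NOT `G′_k`'s decay, NOT the `R`-road, NOT NE9.  NOT summit progress (cell pub-balaban: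
NE9 NOT PRINTED ∕ NOT PROVED; «NE9 ⇐ the named binders»; spine PROVED 0/9; rung (B)+1 finite T⁴ — NOT infinite volume, NOT mass gap, NOT Clay; HONEST
DEPENDENCY: continuum YM on T⁴ ⇐ BetaPertH ∧ nine spine estimates (0/9 proved); BetaPertH ⇐ (D1) ∧ (D4) ∧ CAP+tail; G-an2-4 gates asym, D1 and
NE2/3/4).  NEW file; nothing modified.  Net new unproved facts: 0.
-/

noncomputable section

open scoped BigOperators InnerProductSpace ComplexConjugate

namespace Literature.MathematicalPhysics.QuantumFieldTheory.Balaban1983to89.B9Thm311SitePrimeFormCoerciveTowerPlaquette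

open B4Sect5Torus (TSite)
open B9SectCLatticeCarrier (Bond shift shift_apply_val shift_apply_ne)
open B7Prop1Explicit (U1 l1)
open B7Prop2Explicit (pdev pdev_nonneg avgIter C0 c2' AvgClosed avgIter_mem)
open B7AvgGaugeCovariance (pdev_gaugeAct)
open B9Eq315QTorus (perSite perCfg perCfg_apply)
open B9Eq315QTorusOnto (liftSite)
open B9Eq315QTower (towerP towerP_apply UlevOf)
open B9Eq319QprimeTorus (fineP blockCoord blockCoord_apply_val)
open B11Eq103H1Complex (SiteL2K covDerivL2K)
open B9Eq310HessianOperator (adTransportW)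
open B9Eq324DeltaPrimeATower (laplacePrimeAk)
open B9Eq328GaugeAction (gaugeU gaugeU_apply_dir AdW tau_AdA_of_trace inner_AdW_AdW_of_compat)
open B7Eq44TorusAxialGauge (perCfg_gaugeU')
open B7Eq44TorusAxialGaugeLocal (axialGaugeTAt axialGaugeTAt_apply axialGaugeTAt_mem_U1 star_axialGaugeTAt)
open B9Eq384RemainderLetters (norm_adTransportW_sub_le)
open B9Thm311SmallFieldClosed (hRS_of_unitary)
open B7Eq47BlockGaugeTowerBonds (norm_gaugeU_blockAxial_sub_one_le norm_UlevOf_blockAxial_sub_one_le_profile)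
open B9Thm311SitePrimeFormCoerciveTowerBlockGauge (site_strong_coercive_blockGauge_tower)

variable {d : ℕ} (L : ℕ) [NeZero L] (m : Fin d → ℕ) [∀ i, NeZero (m i)] (n : ℕ)
  {𝔸 : Type*} [NormedRing 𝔸] [NormedAlgebra ℂ 𝔸] [NormOneClass 𝔸] [StarRing 𝔸] [CompleteSpace 𝔸]
  {W : Type*} [NormedAddCommGroup W] [InnerProductSpace ℂ W] (φ : W ≃ₗ[ℂ] 𝔸) (τ : 𝔸 →ₗ[ℂ] ℂ)
  {Mφ Mφ' : ℝ} (hMφ : 0 ≤ Mφ) (hMφ' : 0 ≤ Mφ') (hφ : ∀ w, ‖φ w‖ ≤ Mφ * ‖w‖) (hφ' : ∀ X, ‖φ.symm X‖ ≤ Mφ' * ‖X‖)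
  (hτφ : ∀ X Y : 𝔸, ⟪φ.symm X, φ.symm Y⟫_ℂ = τ (star X * Y)) (htr : ∀ X Y : 𝔸, τ (X * Y) = τ (Y * X))
  (hm : ∀ i, 2 ≤ m i) (hL : 2 ≤ L) {S : Subgroup 𝔸ˣ} (hS : AvgClosed d L S)
  {U : Bond d (towerP L m (n + 1)) → 𝔸ˣ} (hU : ∀ b, U b ∈ S) (hUstar : ∀ b, star (U b : 𝔸) = (((U b)⁻¹ : 𝔸ˣ) : 𝔸))
  {α₀ : ℝ} (hα : 0 < α₀) (hα3 : C0 d * α₀ ≤ 1 / 3) (hα2 : 2 * α₀ ≤ c2' d L)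
  (h52 : pdev (perCfg (towerP L m (n + 1)) U) < α₀ * (((L : ℝ) ^ (n + 1))⁻¹) ^ 2)

/-! ## §1 The suppliers of the displayed slots, at the plaquette class -/

omit [NeZero L] [∀ i, NeZero (m i)] [NormedAlgebra ℂ 𝔸] [StarRing 𝔸] [CompleteSpace 𝔸] in
/-- a level-`(j+1)` bond internal to a level-`j` block and over `y` steps inside `y` (`(x_i div L) div L^j = x_i div L^{j+1}`). [cite: Balaban1985Averaging, (2) p.17] -/
theorem over_shift_of_blockCoord_eq {j : ℕ} {y : TSite d m} {x : TSite d (towerP L m (j + 1))} {μ : Fin d}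
    (hbc : blockCoord L (towerP L m j) x = blockCoord L (towerP L m j) (shift μ x)) (hx : ∀ i, (x i : ℕ) / L ^ (j + 1) = (y i : ℕ)) (i : Fin d) :
    ((shift μ x) i : ℕ) / L ^ (j + 1) = (y i : ℕ) := by
  have h := congrArg (fun z : TSite d (towerP L m j) => (z i : ℕ)) hbc
  simp only [blockCoord_apply_val] at h
  calc ((shift μ x) i : ℕ) / L ^ (j + 1) = ((shift μ x) i : ℕ) / L / L ^ j := by rw [pow_succ', Nat.div_div_eq_div_mul]
    _ = (x i : ℕ) / L / L ^ j := by rw [h]; exact rfl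
    _ = (x i : ℕ) / L ^ (j + 1) := by rw [pow_succ', Nat.div_div_eq_div_mul]
    _ = (y i : ℕ) := hx i

omit [NormOneClass 𝔸] [CompleteSpace 𝔸] in
include hτφ htr hUstar in
/-- **`hAd` FOR THE UNIT-BLOCK AXIAL GAUGES**: `R(u_y(x))` is a fibrewise isometry (unitary gauge values, tracial `τ`).
[cite: Balaban1985BackgroundPropagators, (3.30)–(3.31) p.395; Balaban1985Averaging, (18) p.21] -/
theorem inner_AdW_blockAxial (x₀ x : TSite d (towerP L m (n + 1))) (v v' : W) :
    ⟪AdW φ (axialGaugeTAt (towerP L m (n + 1)) U x₀ x) v, AdW φ (axialGaugeTAt (towerP L m (n + 1)) U x₀ x) v'⟫_ℂ = ⟪v, v'⟫_ℂ :=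
  inner_AdW_AdW_of_compat φ τ hτφ (fun X => tau_AdA_of_trace τ htr _ X) (star_axialGaugeTAt (towerP L m (n + 1)) x₀ hUstar x) v v'

omit [StarRing 𝔸] in
include hL hS hU hα hα3 hα2 h52 in
/-- **THE LEVEL BACKGROUNDS OF `U^{u}` ARE `S`-VALUED** for every `S`-valued gauge `u`, under (52) (`avgIter_mem` at `Ũ^{ũ}`: same class by `pdev_gaugeAct`).
[cite: Balaban1985Averaging, Prop. 2 (52)–(54) p.26, (11) p.19] -/
theorem UlevOf_gauged_mem {g : TSite d (towerP L m (n + 1)) → 𝔸ˣ} (hg : ∀ x, g x ∈ S) {j : ℕ} (hj : j ≤ n) (b : Bond d (towerP L m (j + 1))) :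
    UlevOf L m (n + 1) (gaugeU g U) j b ∈ S := by
  set V := perCfg (towerP L m (n + 1)) (gaugeU g U) with hV
  have hVS : ∀ (x : B7Prop1Explicit.Site d) (μ : Fin d), V x μ ∈ S := fun x μ => by
    rw [hV, perCfg_apply, gaugeU_apply_dir]; exact S.mul_mem (S.mul_mem (hg _) (hU _)) (S.inv_mem (hg _))
  have hpdev : pdev V = pdev (perCfg (towerP L m (n + 1)) U) := by
    rw [hV, perCfg_gaugeU']; exact pdev_gaugeAct (fun z => hS.le_U1 (hg _)) _
  have h := avgIter_mem L hL hS (n + 1) V hVS hα hα3 hα2 (by rw [hpdev]; exact h52) (n - j) (by omega) (liftSite b.1) b.2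
  rw [UlevOf, show n + 1 - 1 - j = n - j by omega]
  exact h

omit [StarRing 𝔸] in
include hS hU in
/-- the torus plaquettes are bounded by `pdev Ũ`. [cite: Balaban1985Averaging, (44) p.24, (52) p.26] -/
theorem norm_plaqHolU_sub_one_le_pdev (x : TSite d (towerP L m (n + 1))) (κ μ : Fin d) (hκμ : κ < μ) :
    ‖(B9Eq310DeltaPrime.plaqHolU U (x, ⟨(κ, μ), hκμ⟩) : 𝔸) - 1‖ ≤ pdev (perCfg (towerP L m (n + 1)) U) := by
  have hVU : ∀ (z : B7Prop1Explicit.Site d) (ν : Fin d), perCfg (towerP L m (n + 1)) U z ν ∈ U1 𝔸 := fun z ν => by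
    rw [perCfg_apply]; exact hS.le_U1 (hU _)
  have h := B7Prop2Explicit.le_pdev hVU (liftSite x) κ μ
  rwa [B7Eq44TorusAxialGauge.hol_perCfg_plaqWord (towerP L m (n + 1)) U (liftSite x) hκμ, B9Eq315QTorusOnto.perSite_liftSite] at h

omit [StarRing 𝔸] in
include hφ hφ' hMφ' hm hS hU in
/-- **`hR` AT THE CLASS — FINE BONDS**: in the unit-block axial gauge `u_y`, every fine bond `(x, μ)` with `x`, `x + e_μ` over `y` has its transporter
`ε`-close to `1`, `ε = 2M_φM_φ′·|n|₁·pdev Ũ` ((T2) + `norm_adTransportW_sub_le`). [cite: Balaban1985BackgroundPropagators, (3.35) p.396, Thm 3.11 p.416; Balaban1985Averaging, pp.24–25] -/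
theorem norm_adTransportW_blockAxial_sub_le (y : TSite d m) (x : TSite d (towerP L m (n + 1))) (μ : Fin d)
    (hx : ∀ i, (x i : ℕ) / L ^ (n + 1) = (y i : ℕ)) (hxμ : ∀ i, ((shift μ x) i : ℕ) / L ^ (n + 1) = (y i : ℕ)) (w : W) :
    ‖adTransportW φ (gaugeU (axialGaugeTAt (towerP L m (n + 1)) U (perSite (towerP L m (n + 1)) (((L : ℤ) ^ (n + 1)) • liftSite y))) U) (x, μ) w - w‖ ≤
      2 * Mφ * Mφ' * ((l1 (fun _ : Fin d => ((L ^ (n + 1) : ℕ) : ℤ) - 1) : ℝ) * pdev (perCfg (towerP L m (n + 1)) U)) * ‖w‖ := by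
  have hU1 : ∀ b, U b ∈ U1 𝔸 := fun b => hS.le_U1 (hU b)
  have hbond := norm_gaugeU_blockAxial_sub_one_le L m n hU1 (pdev_nonneg _) (norm_plaqHolU_sub_one_le_pdev L m n hS hU) hm y x μ hx hxμ
  refine norm_adTransportW_sub_le φ hφ hφ' hMφ' _ (x, μ) ?_ hbond w
  rw [gaugeU_apply_dir]
  exact (U1 𝔸).mul_mem ((U1 𝔸).mul_mem (axialGaugeTAt_mem_U1 _ hU1 _ _) (hU1 _)) ((U1 𝔸).inv_mem (axialGaugeTAt_mem_U1 _ hU1 _ _))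

omit [StarRing 𝔸] in
include hφ hφ' hMφ' hm hL hS hU hα hα3 hα2 h52 in
/-- **`hRlev` AT THE CLASS — LEVEL BONDS**: in the unit-block axial gauge `u_y`, for `j < n+1`, every level-`(j+1)` bond internal to a level-`j` block and
over `y` has its transporter `ε_j`-close to `1`, `ε_j = 2M_φM_φ′·(d + 256(d+1)(d+4))·α₀·L^{n−j}∕N` ((T2)'s profile). [cite: Balaban1985BackgroundPropagators, (3.35)–(3.37) p.396, Thm 3.11 p.416; Balaban1985Averaging, pp.24–26, (52)–(54)] -/
theorem norm_adTransportW_UlevOf_blockAxial_sub_le (y : TSite d m) {j : ℕ} (hj : j < n + 1) (x : TSite d (towerP L m (j + 1))) (μ : Fin d)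
    (hbc : blockCoord L (towerP L m j) x = blockCoord L (towerP L m j) (shift μ x)) (hx : ∀ i, (x i : ℕ) / L ^ (j + 1) = (y i : ℕ)) (w : W) :
    ‖adTransportW φ (UlevOf L m (n + 1)
        (gaugeU (axialGaugeTAt (towerP L m (n + 1)) U (perSite (towerP L m (n + 1)) (((L : ℤ) ^ (n + 1)) • liftSite y))) U) j) (x, μ) w - w‖ ≤
      2 * Mφ * Mφ' * (((d : ℝ) + 256 * (d + 1) * (d + 4)) * α₀ * ((L : ℝ) ^ (n - j) * ((L : ℝ) ^ (n + 1))⁻¹)) * ‖w‖ := by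
  have hj' : j ≤ n := Nat.le_of_lt_succ hj
  have hxμ : ∀ i, ((shift μ x) i : ℕ) / L ^ (j + 1) = (y i : ℕ) := fun i => over_shift_of_blockCoord_eq L m hbc hx i
  have hprof := norm_UlevOf_blockAxial_sub_one_le_profile L m n hL hS hU hα hα3 hα2 h52 hm y hj' x μ hx hxμ
  have hgS : ∀ z, axialGaugeTAt (towerP L m (n + 1)) U (perSite (towerP L m (n + 1)) (((L : ℤ) ^ (n + 1)) • liftSite y)) z ∈ S := fun z => by
    rw [axialGaugeTAt_apply]; exact B7Prop2Explicit.hol_mem_of (fun z κ => by rw [perCfg_apply]; exact hU _) _ _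
  have hmem := hS.le_U1 (UlevOf_gauged_mem L m n hL hS hU hα hα3 hα2 h52 hgS hj' (x, μ))
  exact norm_adTransportW_sub_le φ hφ hφ' hMφ' _ (x, μ) hmem hprof w

/-! ## §2 Thm 3.11 for the k-level site operator at the class (52), explicit letters -/

variable {c₀ c₁ : ℝ} [Fact (0 < c₀)] [Fact (0 < c₁)] [FiniteDimensional ℂ W] {η : ℝ} (hη : η ≠ 0) {a' : ℝ} (ha' : 0 < a')
  (hηN0 : 0 < η * (L : ℝ) ^ (n + 1)) (hs : c₁ * (η * (L : ℝ) ^ (n + 1)) ^ 2 = c₀ * ((L : ℝ) ^ (n + 1)) ^ d)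

include hMφ hMφ' hφ hφ' hτφ htr hm hL hS hU hUstar hα hα3 hα2 h52 hη ha' hηN0 hs in
/-- **[B9] THM 3.11 FOR THE k-LEVEL SITE OPERATOR `Δ′_{a′,k}(U)` AT THE PLAQUETTE CLASS (52), STRONG FORM, EXPLICIT LETTERS**: with
`ε = 2M_φM_φ′·|n|₁·pdev Ũ` and `ε_j = 2M_φM_φ′·Cα₀·L^{n−j}∕N` (`C = d + 256(d+1)(d+4)`, `N = L^{n+1}`):
`(1∕(3 + 4∕a′))·(‖D_Uλ‖² + (1 − κ_k)(ηN)⁻²‖λ‖²) ≤ re⟨λ, Δ′_{a′,k}(U)λ⟩`, `κ_k = 2d(N−1)N·ε² + 4(Π_{j≤n}(1+ε_j)^{d(L−1)} − 1)²` — (T4b) with the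
unit-block axial gauges, §1, `hRS_of_unitary`; nothing displayed. [cite: Balaban1985BackgroundPropagators, (3.24) p.394, p.395, (3.35) p.396, Thm 3.11 p.416; Balaban1985Averaging, (52)–(54) p.26] -/
theorem site_strong_coercive_tower_of_small_plaquettes (lam : SiteL2K ℂ d (towerP L m (n + 1)) c₀ W) :
    (1 / (3 + 4 / a')) * (‖covDerivL2K ℂ c₀ ((η : ℂ))⁻¹ (adTransportW φ U) lam‖ ^ 2 +
        (1 - (2 * d * ((((L ^ (n + 1) - 1 : ℕ) : ℝ)) * ((L ^ (n + 1) - 1 : ℕ) + 1)) *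
            (2 * Mφ * Mφ' * ((l1 (fun _ : Fin d => ((L ^ (n + 1) : ℕ) : ℤ) - 1) : ℝ) * pdev (perCfg (towerP L m (n + 1)) U))) ^ 2 +
          4 * ((∏ j ∈ Finset.range (n + 1), (1 + 2 * Mφ * Mφ' * (((d : ℝ) + 256 * (d + 1) * (d + 4)) * α₀ *
            ((L : ℝ) ^ (n - j) * ((L : ℝ) ^ (n + 1))⁻¹))) ^ (d * (L - 1))) - 1) ^ 2)) *
          (((η * (L : ℝ) ^ (n + 1))⁻¹) ^ 2 * ‖lam‖ ^ 2)) ≤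
      RCLike.re ⟪lam, laplacePrimeAk L m n φ η U a' (c₁ := c₁) lam⟫_ℂ := by
  have hU1 : ∀ b, U b ∈ U1 𝔸 := fun b => hS.le_U1 (hU b)
  have hε : 0 ≤ 2 * Mφ * Mφ' * ((l1 (fun _ : Fin d => ((L ^ (n + 1) : ℕ) : ℤ) - 1) : ℝ) * pdev (perCfg (towerP L m (n + 1)) U)) := by
    have := pdev_nonneg (perCfg (towerP L m (n + 1)) U); positivity
  have hεlev : ∀ j : ℕ, 0 ≤ 2 * Mφ * Mφ' * (((d : ℝ) + 256 * (d + 1) * (d + 4)) * α₀ * ((L : ℝ) ^ (n - j) * ((L : ℝ) ^ (n + 1))⁻¹)) :=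
    fun j => by positivity
  exact site_strong_coercive_blockGauge_tower L m n φ (c₁ := c₁) hη hL hS U hU hα hα3 hα2 h52
    (fun y => axialGaugeTAt (towerP L m (n + 1)) U (perSite (towerP L m (n + 1)) (((L : ℤ) ^ (n + 1)) • liftSite y)))
    (fun y x => axialGaugeTAt_mem_U1 _ hU1 _ x) (fun y x v v' => inner_AdW_blockAxial L m n φ τ hτφ htr hUstar _ x v v') hε
    (fun j => 2 * Mφ * Mφ' * (((d : ℝ) + 256 * (d + 1) * (d + 4)) * α₀ * ((L : ℝ) ^ (n - j) * ((L : ℝ) ^ (n + 1))⁻¹))) hεlev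
    (fun y x μ hx hxμ w => norm_adTransportW_blockAxial_sub_le L m n φ hMφ' hφ hφ' hm hS hU y x μ hx hxμ w)
    (fun y j hj x μ hbc hx w => norm_adTransportW_UlevOf_blockAxial_sub_le L m n φ hMφ' hφ hφ' hm hL hS hU hα hα3 hα2 h52 y hj x μ hbc hx w)
    (hRS_of_unitary φ τ hτφ htr U hUstar) ha' hηN0 hs lam

/-! ## §3 The canonical form — a level-free `κ₀(d, M_φM_φ′α₀)` -/
/-- `(b−1)·Σ_{j≤n} b^{n−j}∕b^{n+1} = 1 − b^{−(n+1)} ≤ 1` (`b > 1`): the profile's geometric series towards the coarse end. [folklore] -/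
private theorem sum_ratio_le {b : ℝ} (hb : 1 < b) (n : ℕ) :
    (b - 1) * ∑ j ∈ Finset.range (n + 1), b ^ (n - j) * (b ^ (n + 1))⁻¹ ≤ 1 := by
  have hrefl : ∑ j ∈ Finset.range (n + 1), b ^ (n - j) = ∑ i ∈ Finset.range (n + 1), b ^ i := by
    have h := Finset.sum_range_reflect (fun i => b ^ i) (n + 1)
    simpa only [Nat.add_sub_cancel] using h
  rw [← Finset.sum_mul, hrefl]
  calc (b - 1) * ((∑ i ∈ Finset.range (n + 1), b ^ i) * (b ^ (n + 1))⁻¹)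
      = ((∑ i ∈ Finset.range (n + 1), b ^ i) * (b - 1)) * (b ^ (n + 1))⁻¹ := by ring
    _ = (b ^ (n + 1) - 1) * (b ^ (n + 1))⁻¹ := by rw [geom_sum_mul]
    _ ≤ b ^ (n + 1) * (b ^ (n + 1))⁻¹ := mul_le_mul_of_nonneg_right (by linarith) (by positivity)
    _ = 1 := mul_inv_cancel₀ (by positivity)

/-- `1 ≤ Π_j (1 + t_j)^p ≤ exp(p·Σ_j t_j)` for `t_j ≥ 0`. [folklore] -/
private theorem one_le_prod_pow {s : Finset ℕ} {t : ℕ → ℝ} (ht : ∀ j, 0 ≤ t j) (p : ℕ) :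
    1 ≤ ∏ j ∈ s, (1 + t j) ^ p ∧ ∏ j ∈ s, (1 + t j) ^ p ≤ Real.exp (p * ∑ j ∈ s, t j) := by
  refine ⟨?_, ?_⟩
  · calc (1 : ℝ) = ∏ _j ∈ s, (1 : ℝ) := Finset.prod_const_one.symm
      _ ≤ ∏ j ∈ s, (1 + t j) ^ p := Finset.prod_le_prod (fun _ _ => zero_le_one) (fun j _ => one_le_pow₀ (by linarith [ht j]))
  · calc ∏ j ∈ s, (1 + t j) ^ p ≤ ∏ j ∈ s, Real.exp (t j) ^ p :=
          Finset.prod_le_prod (fun j _ => pow_nonneg (by linarith [ht j]) _)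
            (fun j _ => pow_le_pow_left₀ (by linarith [ht j]) (by linarith [Real.add_one_le_exp (t j)]) p)
      _ = Real.exp (p * ∑ j ∈ s, t j) := by
          rw [Finset.mul_sum, Real.exp_sum]; exact Finset.prod_congr rfl (fun j _ => (Real.exp_nat_mul (t j) p).symm)

/-- `e^x − 1 ≤ x·e^x` (from `1 − x ≤ e^{−x}`). [folklore] -/
private theorem exp_sub_one_le_mul_exp (x : ℝ) : Real.exp x - 1 ≤ x * Real.exp x := by
  have h := mul_le_mul_of_nonneg_left (Real.add_one_le_exp (-x)) (Real.exp_pos x).le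
  have he : Real.exp x * Real.exp (-x) = 1 := by rw [← Real.exp_add, add_neg_cancel, Real.exp_zero]
  nlinarith [h, he, Real.exp_pos x]

/-- `|(N−1, …, N−1)|₁ ≤ d·N`. [folklore] -/
private theorem l1_box_le (N : ℕ) (hN : 1 ≤ N) : (l1 (fun _ : Fin d => ((N : ℕ) : ℤ) - 1) : ℝ) ≤ d * N := by
  unfold l1
  rw [Finset.sum_const, Finset.card_univ, Fintype.card_fin, smul_eq_mul]
  have e : ((N : ℕ) : ℤ) - 1 = ((N - 1 : ℕ) : ℤ) := by omega
  rw [e, Int.natAbs_natCast]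
  push_cast
  have : ((N - 1 : ℕ) : ℝ) ≤ N := by exact_mod_cast Nat.sub_le N 1
  exact mul_le_mul_of_nonneg_left this (Nat.cast_nonneg d)

/-- the displayed lower bound is antitone in `κ`. [folklore] -/
private theorem lower_mono {γ D M κ κ' X : ℝ} (hγ : 0 ≤ γ) (hM : 0 ≤ M) (hκ : κ ≤ κ') (h : γ * (D + (1 - κ) * M) ≤ X) :
    γ * (D + (1 - κ') * M) ≤ X :=
  le_trans (mul_le_mul_of_nonneg_left (by nlinarith [mul_le_mul_of_nonneg_right hκ hM]) hγ) h
set_option maxHeartbeats 400000 in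
include hMφ hMφ' hφ hφ' hτφ htr hm hL hS hU hUstar hα hα3 hα2 h52 hη ha' hηN0 hs in
/-- **THE CANONICAL FORM AT LEVEL k — CONSTANTS FREE OF `k, η, m, L, c₀, c₁`**: with `A := M_φM_φ′α₀`, `C := d + 256(d+1)(d+4)` and
`κ₀ := 8d³A² + 4(2dCA·e^{2dCA})²`:  `(1∕(3 + 4∕a′))·(‖D_Uλ‖² + (1 − κ₀)(ηN)⁻²‖λ‖²) ≤ re⟨λ, Δ′_{a′,k}(U)λ⟩` (`N = L^{n+1} = L^k`).  The two counts:
`ε ≤ 2dA∕N` (`|n|₁ ≤ dN`, `pdev Ũ < α₀N⁻²`) so `2d(N−1)N·ε² ≤ 8d³A²`; and `Σ_{j≤n} ε_j = 2CA·Σ_{i=1}^{k} L^{−i} ≤ 2CA∕(L−1)`, so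
`Π_j(1+ε_j)^{d(L−1)} ≤ e^{2dCA}` — the LENGTH count over one unit block is summable down the tower (ratio `1∕L`): NO level count, no volume; Thm 3.11's
first clause for `Δ′_a` of (3.24) at (3.35)'s class, `O(1)` constant «uniformly in k» (p. 395). [cite: Balaban1985BackgroundPropagators, (3.24) p.394, p.395, (3.35)–(3.37) p.396, Thm 3.11 p.416; Balaban1985Averaging, (52)–(54) p.26; Balaban1987RG1, (1.12) p.262] -/
theorem site_strong_coercive_tower_of_small_plaquettes_canonical (lam : SiteL2K ℂ d (towerP L m (n + 1)) c₀ W) :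
    (1 / (3 + 4 / a')) * (‖covDerivL2K ℂ c₀ ((η : ℂ))⁻¹ (adTransportW φ U) lam‖ ^ 2 +
        (1 - (8 * d ^ 3 * (Mφ * Mφ' * α₀) ^ 2 +
          4 * (2 * d * ((d : ℝ) + 256 * (d + 1) * (d + 4)) * (Mφ * Mφ' * α₀) *
            Real.exp (2 * d * ((d : ℝ) + 256 * (d + 1) * (d + 4)) * (Mφ * Mφ' * α₀))) ^ 2)) *
          (((η * (L : ℝ) ^ (n + 1))⁻¹) ^ 2 * ‖lam‖ ^ 2)) ≤
      RCLike.re ⟪lam, laplacePrimeAk L m n φ η U a' (c₁ := c₁) lam⟫_ℂ := by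
  have hmain := site_strong_coercive_tower_of_small_plaquettes L m n φ (c₁ := c₁) τ hMφ hMφ' hφ hφ' hτφ htr hm hL hS hU hUstar
    hα hα3 hα2 h52 hη ha' hηN0 hs lam
  obtain ⟨C, hC⟩ : ∃ C : ℝ, C = (d : ℝ) + 256 * (d + 1) * (d + 4) := ⟨_, rfl⟩
  rw [← hC] at hmain ⊢
  have hC0 : 0 ≤ C := by rw [hC]; positivity
  have hL2r : (2 : ℝ) ≤ L := by exact_mod_cast hL
  have hL1n : 1 ≤ L := le_trans (by norm_num) hL
  have hN0 : (0 : ℝ) < (L : ℝ) ^ (n + 1) := by positivity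
  have hMM : 0 ≤ Mφ * Mφ' := mul_nonneg hMφ hMφ'
  set A := Mφ * Mφ' * α₀ with hA
  have hA0 : 0 ≤ A := mul_nonneg hMM hα.le
  -- the fine-bond count: `ε ≤ 2dA∕N`
  set ε := 2 * Mφ * Mφ' * ((l1 (fun _ : Fin d => ((L ^ (n + 1) : ℕ) : ℤ) - 1) : ℝ) * pdev (perCfg (towerP L m (n + 1)) U)) with hεdef
  have hδ0 : 0 ≤ pdev (perCfg (towerP L m (n + 1)) U) := pdev_nonneg _
  have hl1 := l1_box_le (d := d) (L ^ (n + 1)) (Nat.one_le_pow _ _ (by omega))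
  rw [(Nat.cast_pow L (n + 1) : ((L ^ (n + 1) : ℕ) : ℝ) = (L : ℝ) ^ (n + 1))] at hl1
  have hε0 : 0 ≤ ε := by rw [hεdef]; positivity
  have hεle : ε ≤ 2 * d * A * ((L : ℝ) ^ (n + 1))⁻¹ := by
    have h1 : (l1 (fun _ : Fin d => ((L ^ (n + 1) : ℕ) : ℤ) - 1) : ℝ) * pdev (perCfg (towerP L m (n + 1)) U) ≤
        (d * (L : ℝ) ^ (n + 1)) * (α₀ * (((L : ℝ) ^ (n + 1))⁻¹) ^ 2) := mul_le_mul hl1 h52.le hδ0 (by positivity)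
    calc ε = 2 * (Mφ * Mφ') * ((l1 (fun _ : Fin d => ((L ^ (n + 1) : ℕ) : ℤ) - 1) : ℝ) * pdev (perCfg (towerP L m (n + 1)) U)) := by
          rw [hεdef]; ring
      _ ≤ 2 * (Mφ * Mφ') * ((d * (L : ℝ) ^ (n + 1)) * (α₀ * (((L : ℝ) ^ (n + 1))⁻¹) ^ 2)) := mul_le_mul_of_nonneg_left h1 (by positivity)
      _ = 2 * d * A * ((L : ℝ) ^ (n + 1))⁻¹ * ((L : ℝ) ^ (n + 1) * ((L : ℝ) ^ (n + 1))⁻¹) := by rw [hA]; ring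
      _ = 2 * d * A * ((L : ℝ) ^ (n + 1))⁻¹ := by rw [mul_inv_cancel₀ hN0.ne', mul_one]
  have hNn : (((L ^ (n + 1) - 1 : ℕ) : ℝ)) * (((L ^ (n + 1) - 1 : ℕ) : ℝ) + 1) ≤ (L : ℝ) ^ (n + 1) * (L : ℝ) ^ (n + 1) := by
    have e : (((L ^ (n + 1) - 1 : ℕ) : ℝ)) = (L : ℝ) ^ (n + 1) - 1 := by
      rw [Nat.cast_sub (Nat.one_le_pow _ _ (by omega)), Nat.cast_pow, Nat.cast_one]
    rw [e]; nlinarith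
  have h1 : 2 * d * ((((L ^ (n + 1) - 1 : ℕ) : ℝ)) * ((L ^ (n + 1) - 1 : ℕ) + 1)) * ε ^ 2 ≤ 8 * d ^ 3 * A ^ 2 := by
    have hεsq : ε ^ 2 ≤ (2 * d * A * ((L : ℝ) ^ (n + 1))⁻¹) ^ 2 := pow_le_pow_left₀ hε0 hεle 2
    calc 2 * d * ((((L ^ (n + 1) - 1 : ℕ) : ℝ)) * ((L ^ (n + 1) - 1 : ℕ) + 1)) * ε ^ 2 ≤
        2 * d * ((L : ℝ) ^ (n + 1) * (L : ℝ) ^ (n + 1)) * (2 * d * A * ((L : ℝ) ^ (n + 1))⁻¹) ^ 2 :=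
          mul_le_mul (mul_le_mul_of_nonneg_left hNn (by positivity)) hεsq (by positivity) (by positivity)
      _ = 8 * d ^ 3 * A ^ 2 * ((L : ℝ) ^ (n + 1) * ((L : ℝ) ^ (n + 1))⁻¹) ^ 2 := by ring
      _ = 8 * d ^ 3 * A ^ 2 := by rw [mul_inv_cancel₀ hN0.ne', one_pow, mul_one]
  -- the averaged-bond count: `Σ_j ε_j ≤ 2CA∕(L−1)`, `Π_j (1+ε_j)^{d(L−1)} ≤ e^{2dCA}`
  have hsum : ((L : ℝ) - 1) * ∑ j ∈ Finset.range (n + 1), 2 * Mφ * Mφ' * (C * α₀ * ((L : ℝ) ^ (n - j) * ((L : ℝ) ^ (n + 1))⁻¹)) ≤ 2 * C * A := by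
    have e : ∀ j : ℕ, 2 * Mφ * Mφ' * (C * α₀ * ((L : ℝ) ^ (n - j) * ((L : ℝ) ^ (n + 1))⁻¹)) =
        (2 * C * A) * ((L : ℝ) ^ (n - j) * ((L : ℝ) ^ (n + 1))⁻¹) := fun j => by rw [hA]; ring
    simp only [e, ← Finset.mul_sum]
    calc ((L : ℝ) - 1) * (2 * C * A * ∑ j ∈ Finset.range (n + 1), (L : ℝ) ^ (n - j) * ((L : ℝ) ^ (n + 1))⁻¹)
        = 2 * C * A * (((L : ℝ) - 1) * ∑ j ∈ Finset.range (n + 1), (L : ℝ) ^ (n - j) * ((L : ℝ) ^ (n + 1))⁻¹) := by ring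
      _ ≤ 2 * C * A * 1 := mul_le_mul_of_nonneg_left (sum_ratio_le (by linarith) n) (by positivity)
      _ = 2 * C * A := mul_one _
  have hdL : (((d * (L - 1) : ℕ)) : ℝ) = d * ((L : ℝ) - 1) := by rw [Nat.cast_mul, Nat.cast_sub hL1n, Nat.cast_one]
  have hpS : (((d * (L - 1) : ℕ)) : ℝ) * ∑ j ∈ Finset.range (n + 1), 2 * Mφ * Mφ' * (C * α₀ * ((L : ℝ) ^ (n - j) * ((L : ℝ) ^ (n + 1))⁻¹)) ≤
      2 * d * C * A := by
    rw [hdL]; nlinarith [mul_le_mul_of_nonneg_left hsum (Nat.cast_nonneg d)]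
  have hprod := one_le_prod_pow (s := Finset.range (n + 1))
    (t := fun j => 2 * Mφ * Mφ' * (C * α₀ * ((L : ℝ) ^ (n - j) * ((L : ℝ) ^ (n + 1))⁻¹))) (fun j => by positivity) (d * (L - 1))
  have hρ0 : 0 ≤ (∏ j ∈ Finset.range (n + 1), (1 + 2 * Mφ * Mφ' * (C * α₀ * ((L : ℝ) ^ (n - j) * ((L : ℝ) ^ (n + 1))⁻¹))) ^ (d * (L - 1))) - 1 := by
    linarith [hprod.1]
  have hρle : (∏ j ∈ Finset.range (n + 1), (1 + 2 * Mφ * Mφ' * (C * α₀ * ((L : ℝ) ^ (n - j) * ((L : ℝ) ^ (n + 1))⁻¹))) ^ (d * (L - 1))) - 1 ≤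
      2 * d * C * A * Real.exp (2 * d * C * A) := by
    linarith [hprod.2, Real.exp_le_exp.2 hpS, exp_sub_one_le_mul_exp (2 * d * C * A)]
  have hκ : 2 * d * ((((L ^ (n + 1) - 1 : ℕ) : ℝ)) * ((L ^ (n + 1) - 1 : ℕ) + 1)) * ε ^ 2 +
      4 * ((∏ j ∈ Finset.range (n + 1), (1 + 2 * Mφ * Mφ' * (C * α₀ * ((L : ℝ) ^ (n - j) * ((L : ℝ) ^ (n + 1))⁻¹))) ^ (d * (L - 1))) - 1) ^ 2 ≤
      8 * d ^ 3 * A ^ 2 + 4 * (2 * d * C * A * Real.exp (2 * d * C * A)) ^ 2 :=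
    add_le_add h1 (mul_le_mul_of_nonneg_left (pow_le_pow_left₀ hρ0 hρle 2) (by norm_num))
  exact lower_mono (by positivity) (by positivity) hκ hmain

include hMφ hMφ' hφ hφ' hτφ htr hm hL hS hU hUstar hα hα3 hα2 h52 hη ha' hηN0 hs in
/-- **THE `hpos′` SLOT OF THE TOWER CHAIN AT THE PLAQUETTE CLASS**: if `κ₀ < 1` (smallness of `A = M_φM_φ′α₀` ONLY), then `0 < re⟨λ, Δ′_{a′,k}(U)λ⟩`
for `λ ≠ 0` — «Δ′_a … positive definite», so `G′_k(U) = (Δ′_{a′,k}(U))⁻¹` (3.25) exists on the class (52). [cite: Balaban1985BackgroundPropagators, (3.25) p.394, p.395, Thm 3.11 p.416] -/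
theorem laplacePrimeAk_pos_of_small_plaquettes
    (hκ₀ : 8 * d ^ 3 * (Mφ * Mφ' * α₀) ^ 2 + 4 * (2 * d * ((d : ℝ) + 256 * (d + 1) * (d + 4)) * (Mφ * Mφ' * α₀) *
        Real.exp (2 * d * ((d : ℝ) + 256 * (d + 1) * (d + 4)) * (Mφ * Mφ' * α₀))) ^ 2 < 1)
    (lam : SiteL2K ℂ d (towerP L m (n + 1)) c₀ W) (hlam : lam ≠ 0) :
    0 < RCLike.re ⟪lam, laplacePrimeAk L m n φ η U a' (c₁ := c₁) lam⟫_ℂ := by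
  have h := site_strong_coercive_tower_of_small_plaquettes_canonical L m n φ (c₁ := c₁) τ hMφ hMφ' hφ hφ' hτφ htr hm hL hS hU hUstar
    hα hα3 hα2 h52 hη ha' hηN0 hs lam
  have hγ : 0 < 1 / (3 + 4 / a') := by positivity
  have hM : 0 < ((η * (L : ℝ) ^ (n + 1))⁻¹) ^ 2 * ‖lam‖ ^ 2 := by positivity
  have hD0 : 0 ≤ ‖covDerivL2K ℂ c₀ ((η : ℂ))⁻¹ (adTransportW φ U) lam‖ ^ 2 := by positivity
  exact lt_of_lt_of_le (mul_pos hγ (by linarith [mul_pos (sub_pos.2 hκ₀) hM])) h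

/-! ## §4 The (SC) quantifier shape — `∃ A₁ γ > 0` before the lattice, the level and the field -/
include hMφ hMφ' hφ hφ' hτφ htr ha' in
/-- **`∃ A₁(d) γ(a′) > 0` BEFORE `∀ L ∀ S ∀ k ∀ m ∀ U ∀ α₀ ∀ η ∀ c₀ c₁`**: with `γ = 1∕(2(3 + 4∕a′))` and
`A₁ := min (1∕(4dC + 1)) (1∕(2C_d))`, `C = d + 256(d+1)(d+4)`, `C_d = 8d³ + 16e·d²C² + 1`: on EVERY tower lattice `towerP L m (k)` (`2 ≤ L`,
`2 ≤ m_i`, every level `k = n+1`), for EVERY unitary `U` with values in an averaging-closed class `S ≤ U1` obeying print's (52)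
`pdev Ũ < α₀L^{−2k}` with `C₀α₀ ≤ 1∕3`, `2α₀ ≤ c₂′`, `M_φM_φ′α₀ ≤ A₁`, along `c₁(ηN)² = c₀N^d`, `0 < ηN`:
`γ·(‖D_Uλ‖² + (ηN)⁻²‖λ‖²) ≤ re⟨λ, Δ′_{a′,k}(U)λ⟩` (`κ₀(A) ≤ A·C_d ≤ 1∕2`) — Thm 3.11 ∕ p. 395 for the k-level site operator, uniformly in the lattice
AND the level, at the gauge-invariant class. [cite: Balaban1985BackgroundPropagators, p.395, (3.35) p.396, Thm 3.11 p.416; Balaban1985Averaging, (52) p.26; Balaban1987RG1, (1.11)–(1.12) p.262] -/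
theorem exists_site_strong_coercive_tower_of_small_plaquettes :
    ∃ A₁ γ : ℝ, 0 < A₁ ∧ 0 < γ ∧
      ∀ (L : ℕ) [NeZero L], 2 ≤ L → ∀ (S : Subgroup 𝔸ˣ), AvgClosed d L S →
      ∀ (n : ℕ) (m : Fin d → ℕ) [∀ i, NeZero (m i)], (∀ i, 2 ≤ m i) →
      ∀ (U : Bond d (towerP L m (n + 1)) → 𝔸ˣ), (∀ b, U b ∈ S) → (∀ b, star (U b : 𝔸) = (((U b)⁻¹ : 𝔸ˣ) : 𝔸)) →
      ∀ (α₀ : ℝ), 0 < α₀ → C0 d * α₀ ≤ 1 / 3 → 2 * α₀ ≤ c2' d L →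
        pdev (perCfg (towerP L m (n + 1)) U) < α₀ * (((L : ℝ) ^ (n + 1))⁻¹) ^ 2 → Mφ * Mφ' * α₀ ≤ A₁ →
      ∀ (η : ℝ), 0 < η * (L : ℝ) ^ (n + 1) →
      ∀ (c₀ c₁ : ℝ) [Fact (0 < c₀)] [Fact (0 < c₁)], c₁ * (η * (L : ℝ) ^ (n + 1)) ^ 2 = c₀ * ((L : ℝ) ^ (n + 1)) ^ d →
      ∀ lam : SiteL2K ℂ d (towerP L m (n + 1)) c₀ W,
        γ * (‖covDerivL2K ℂ c₀ ((η : ℂ))⁻¹ (adTransportW φ U) lam‖ ^ 2 + ((η * (L : ℝ) ^ (n + 1))⁻¹) ^ 2 * ‖lam‖ ^ 2) ≤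
          RCLike.re ⟪lam, laplacePrimeAk L m n φ η U a' (c₁ := c₁) lam⟫_ℂ := by
  obtain ⟨C, hC⟩ : ∃ C : ℝ, C = (d : ℝ) + 256 * (d + 1) * (d + 4) := ⟨_, rfl⟩
  have hC0 : 0 ≤ C := by rw [hC]; positivity
  obtain ⟨Cd, hCd⟩ : ∃ Cd : ℝ, Cd = 8 * (d : ℝ) ^ 3 + 16 * (d : ℝ) ^ 2 * C ^ 2 * Real.exp 1 + 1 := ⟨_, rfl⟩
  have hCd0 : 0 < Cd := by rw [hCd]; positivity
  refine ⟨min (1 / (4 * d * C + 1)) (1 / (2 * Cd)), 1 / (2 * (3 + 4 / a')), lt_min (by positivity) (by positivity), by positivity, ?_⟩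
  intro L _ hL S hS n m _ hm U hU hUstar α₀ hα hα3 hα2 h52 hA η hηN0 c₀ c₁ _ _ hs lam
  have hη : η ≠ 0 := by rintro rfl; simp at hηN0
  have hmain := site_strong_coercive_tower_of_small_plaquettes_canonical L m n φ (c₁ := c₁) τ hMφ hMφ' hφ hφ' hτφ htr hm hL hS hU
    hUstar hα hα3 hα2 h52 hη ha' hηN0 hs lam
  rw [← hC] at hmain
  obtain ⟨A, hAdef⟩ : ∃ A : ℝ, A = Mφ * Mφ' * α₀ := ⟨_, rfl⟩
  rw [← hAdef] at hmain hA
  obtain ⟨Dn, hDn⟩ : ∃ Dn : ℝ, Dn = ‖covDerivL2K ℂ c₀ ((η : ℂ))⁻¹ (adTransportW φ U) lam‖ ^ 2 := ⟨_, rfl⟩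
  rw [← hDn] at hmain ⊢
  obtain ⟨Mn, hMn⟩ : ∃ Mn : ℝ, Mn = ((η * (L : ℝ) ^ (n + 1))⁻¹) ^ 2 * ‖lam‖ ^ 2 := ⟨_, rfl⟩
  rw [← hMn] at hmain ⊢
  obtain ⟨K0, hK0⟩ : ∃ K0 : ℝ, K0 = 8 * (d : ℝ) ^ 3 * A ^ 2 + 4 * (2 * d * C * A * Real.exp (2 * d * C * A)) ^ 2 := ⟨_, rfl⟩
  rw [← hK0] at hmain
  have hA0 : 0 ≤ A := by rw [hAdef]; exact mul_nonneg (mul_nonneg hMφ hMφ') hα.le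
  have hdC : (0 : ℝ) ≤ 4 * d * C := by positivity
  have hA1' : A ≤ 1 / (4 * d * C + 1) := hA.trans (min_le_left _ _)
  have hA1 : A ≤ 1 := hA1'.trans (by rw [div_le_one (by positivity)]; linarith)
  have hA2 : A ≤ 1 / (2 * Cd) := hA.trans (min_le_right _ _)
  have hexp : Real.exp (4 * d * C * A) ≤ Real.exp 1 := Real.exp_le_exp.2 ((mul_le_mul_of_nonneg_left hA1' hdC).trans (by
    rw [mul_one_div, div_le_one (by positivity)]; linarith))
  have hsq : (2 * d * C * A * Real.exp (2 * d * C * A)) ^ 2 = 4 * d ^ 2 * C ^ 2 * A ^ 2 * Real.exp (4 * d * C * A) := by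
    have e2 : Real.exp (2 * d * C * A) ^ 2 = Real.exp (4 * d * C * A) := by
      rw [sq, ← Real.exp_add]; ring_nf
    calc (2 * d * C * A * Real.exp (2 * d * C * A)) ^ 2 = (2 * d * C * A) ^ 2 * Real.exp (2 * d * C * A) ^ 2 := mul_pow _ _ 2
      _ = 4 * d ^ 2 * C ^ 2 * A ^ 2 * Real.exp (4 * d * C * A) := by rw [e2]; ring
  have hκ : K0 ≤ A * Cd := by
    rw [hK0, hsq, hCd]
    have hAA : A ^ 2 ≤ A := by nlinarith
    have h1 : 8 * (d : ℝ) ^ 3 * A ^ 2 ≤ 8 * (d : ℝ) ^ 3 * A := mul_le_mul_of_nonneg_left hAA (by positivity)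
    have h3 : A ^ 2 * Real.exp (4 * d * C * A) ≤ A * Real.exp 1 := mul_le_mul hAA hexp (by positivity) hA0
    have h2 := mul_le_mul_of_nonneg_left h3 (show (0 : ℝ) ≤ 16 * (d : ℝ) ^ 2 * C ^ 2 by positivity)
    linarith [h1, h2]
  have hκ2 : A * Cd ≤ 1 / 2 := by
    calc A * Cd ≤ 1 / (2 * Cd) * Cd := mul_le_mul_of_nonneg_right hA2 hCd0.le
      _ = 1 / 2 := by field_simp
  have hM0 : 0 ≤ Mn := by rw [hMn]; positivity
  have hD0 : 0 ≤ Dn := by rw [hDn]; positivity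
  have hγ0 : 0 < 1 / (3 + 4 / a') := by positivity
  have hhalf : (1 : ℝ) / 2 ≤ 1 - K0 := by linarith
  have hlow : 1 / 2 * Mn ≤ (1 - K0) * Mn := mul_le_mul_of_nonneg_right hhalf hM0
  have h2 : 1 / 2 * (Dn + Mn) ≤ Dn + (1 - K0) * Mn := by linarith
  have e : 1 / (2 * (3 + 4 / a')) = (1 / (3 + 4 / a')) * (1 / 2) := by field_simp
  rw [e, mul_assoc]
  exact (mul_le_mul_of_nonneg_left h2 hγ0.le).trans hmain

end Literature.MathematicalPhysics.QuantumFieldTheory.Balaban1983to89.B9Thm311SitePrimeFormCoerciveTowerPlaquette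

end
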